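import Mathlib
import Literature.Computability.AlgebraicComplexity.EquivariantDC
import Summits.ValiantsHypothesis.ValiantsHypothesis.Theorems.RigidityForcesSymmetryRankRigidMinimalReprTiedTorusDefs
import Summits.ValiantsHypothesis.ValiantsHypothesis.Theorems.RigidityForcesSymmetryRankRigidMinimalReprLaplaceOptimalSmall

/-!
# The rungs `TiedTorusBound 1` and `TiedTorusBound 2` from the dictionary stub alone
# (crux `RankRigidMinimalRepr`, stmt-ValiantsHypothesis-18034, route `RigidityForcesSymmetry`)

The line `PairTiedTorusBound` composes its rung `TiedTorusBound 1` (Grenet's bound `2^m - 1` for affine determinantal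
representations of `perm_m` equivariant under the two-sided torus with ONE pair of column scalars tied) from two registered stubs:
the DICTIONARY `stub_levelDecomp` (an equivariant representation of size `n` yields typed level decompositions with `w s` products,
`1 + Σ_s w s ≤ n`) and the COUNT `stub_levelBound` (landed: `…StubLevelBound.lean`).  With the counts now landed for the ties
`k = 1` AND `k = 2` (engine `levelBound_of_laplaceOptimal` + `laplaceOptimal_two/three`, `…LevelBoundOfLaplace.lean`,
`…LaplaceOptimalSmall.lean`), this file records IN KERNEL FORM what remains: CONDITIONAL on the dictionary statement (taken as an
explicit hypothesis `hdec`, verbatim the registered stub `stub_levelDecomp` over the tree copies `tiedTorus` / `TiedLevelDecomposable`),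

* `tiedTorusBound_one_of_levelDecomp : hdec → TiedTorusBound 1` (the rung `PairTiedTorusBound`),
* `tiedTorusBound_two_of_levelDecomp : hdec → TiedTorusBound 2` (the NEXT rung, two pairs… i.e. three columns tied),
* `grenetBound_of_levelDecomp_of_laplaceOptimal : hdec → LaplaceOptimal (k+1) → (Grenet's bound for `tiedTorus m k`, `m ≥ k+1`)`.

So the dictionary stub alone now closes TWO rungs of the ladder.  HONEST FRAMING: CONDITIONAL results (hypothesis = an unproved
registered stub of this crux, stated inline as a hypothesis, not as a fact); the arithmetic `grenet_count_of_levels` is copied from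
the workfile; nothing here bears on `VP ≠ VNP`.
-/

set_option autoImplicit false

-- the mandated summit-side namespace repeats a component by design (single-problem summit)
set_option linter.dupNamespace false

open Finset
open Literature.Computability.AlgebraicComplexity
open Summit.ValiantsHypothesis.ValiantsHypothesis.Theorems.RigidityForcesSymmetryPairTiedTorusBound

namespace Summit.ValiantsHypothesis.ValiantsHypothesis.Theorems.RigidityForcesSymmetryRankRigidMinimalRepr

/-- Arithmetic of the level count: `n ≥ 1 + Σ_{s=1}^{m-1} C(m,s) = 2^m - 1` (copied from the workfile's
`grenet_count_of_levels`). -/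
theorem grenet_count_of_levels {m n : ℕ} (hm : 3 ≤ m) (w : ℕ → ℕ)
    (hsum : (∑ s ∈ Finset.range (m - 1), w (s + 1)) + 1 ≤ n)
    (hle : ∀ s : ℕ, 1 ≤ s → s + 1 ≤ m → m.choose s ≤ w s) : 2 ^ m - 1 ≤ n := by
  have hle' : ∀ s ∈ Finset.range (m - 1), m.choose (s + 1) ≤ w (s + 1) := fun s hs => by
    rw [Finset.mem_range] at hs
    exact hle (s + 1) (Nat.succ_pos s) (by omega)
  have hchoose : (∑ s ∈ Finset.range (m - 1), m.choose (s + 1)) + 2 = 2 ^ m := by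
    obtain ⟨m', rfl⟩ : ∃ m', m = m' + 1 := ⟨m - 1, by omega⟩
    have h := Nat.sum_range_choose (m' + 1)
    rw [Finset.sum_range_succ', Finset.sum_range_succ] at h
    simp only [Nat.choose_zero_right, Nat.choose_self, Nat.add_sub_cancel] at h ⊢
    omega
  have hsum' := Finset.sum_le_sum hle'
  calc 2 ^ m - 1 = (∑ s ∈ Finset.range (m - 1), m.choose (s + 1)) + 1 := by omega
    _ ≤ (∑ s ∈ Finset.range (m - 1), w (s + 1)) + 1 := by omega
    _ ≤ n := hsum

/-- **Grenet's bound for the tie `k` from the dictionary and `LaplaceOptimal (k + 1)`** (for `m ≥ max(3, k+1)`): the dictionary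
statement `hdec` (= the registered stub `stub_levelDecomp`, taken as a hypothesis) gives typed level decompositions with `w s`
products and `1 + Σ_s w s ≤ n`; the engine bounds each `w s ≥ C(m, s)`; the levels sum to `2^m - 1`. -/
theorem grenetBound_of_levelDecomp_of_laplaceOptimal
    (hdec : ∀ m k : ℕ, 3 ≤ m → ∀ (n : ℕ) (A : Matrix (Fin n) (Fin n) (MvPolynomial (Fin m × Fin m) ℂ)),
      IsEquivariantDetRepr (tiedTorus m k) (perPoly (Fin m) ℂ) A →
        ∃ w : ℕ → ℕ, (∑ s ∈ Finset.range (m - 1), w (s + 1)) + 1 ≤ n ∧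
          ∀ s : ℕ, 1 ≤ s → s + 1 ≤ m → TiedLevelDecomposable m k s (w s))
    {k : ℕ} (hL : LaplaceOptimal (k + 1)) :
    ∀ m : ℕ, 3 ≤ m → k + 1 ≤ m → ∀ (n : ℕ) (A : Matrix (Fin n) (Fin n) (MvPolynomial (Fin m × Fin m) ℂ)),
      IsEquivariantDetRepr (tiedTorus m k) (perPoly (Fin m) ℂ) A → 2 ^ m - 1 ≤ n := by
  intro m hm hkm n A hA
  obtain ⟨w, hsum, hlev⟩ := hdec m k hm n A hA
  exact grenet_count_of_levels hm w hsum fun s hs hsm =>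
    levelBound_of_laplaceOptimal hL m hkm s (w s) (by omega) (hlev s hs hsm)

/-- **The rung `PairTiedTorusBound` (= `TiedTorusBound 1`) from the dictionary stub alone** — the count `stub_levelBound` /
`laplaceOptimal_two` being landed. -/
theorem tiedTorusBound_one_of_levelDecomp
    (hdec : ∀ m k : ℕ, 3 ≤ m → ∀ (n : ℕ) (A : Matrix (Fin n) (Fin n) (MvPolynomial (Fin m × Fin m) ℂ)),
      IsEquivariantDetRepr (tiedTorus m k) (perPoly (Fin m) ℂ) A →
        ∃ w : ℕ → ℕ, (∑ s ∈ Finset.range (m - 1), w (s + 1)) + 1 ≤ n ∧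
          ∀ s : ℕ, 1 ≤ s → s + 1 ≤ m → TiedLevelDecomposable m k s (w s)) :
    TiedTorusBound 1 :=
  fun m hm n A hA => grenetBound_of_levelDecomp_of_laplaceOptimal hdec laplaceOptimal_two m hm (by omega) n A hA

/-- **The next rung `TiedTorusBound 2` (three columns tied) from the dictionary stub alone** — the count
`levelBound_threeTied` / `laplaceOptimal_three` being landed. -/
theorem tiedTorusBound_two_of_levelDecomp
    (hdec : ∀ m k : ℕ, 3 ≤ m → ∀ (n : ℕ) (A : Matrix (Fin n) (Fin n) (MvPolynomial (Fin m × Fin m) ℂ)),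
      IsEquivariantDetRepr (tiedTorus m k) (perPoly (Fin m) ℂ) A →
        ∃ w : ℕ → ℕ, (∑ s ∈ Finset.range (m - 1), w (s + 1)) + 1 ≤ n ∧
          ∀ s : ℕ, 1 ≤ s → s + 1 ≤ m → TiedLevelDecomposable m k s (w s)) :
    TiedTorusBound 2 :=
  fun m hm n A hA => grenetBound_of_levelDecomp_of_laplaceOptimal hdec laplaceOptimal_three m hm (by omega) n A hA

end Summit.ValiantsHypothesis.ValiantsHypothesis.Theorems.RigidityForcesSymmetryRankRigidMinimalRepr
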